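import Literature.NumberTheory.LFunctions.PrimeSumStandardWeights
import Literature.NumberTheory.LFunctions.MidpointSieveGain
import Mathlib.Analysis.Complex.ExponentialBounds
import HarnessLib

/-!
# Primes in `[y, x]`: `#{y ≤ p ≤ x} = x/log x − y/log y + O(x/log² y)` for all `2 ≤ y ≤ x`

Topic `Literature/NumberTheory/LFunctions`. Everything here is PROVED (no definitions, no named
facts). With `#{⌈y⌉ ≤ p ≤ ⌊x⌋} = #((Finset.Icc ⌈y⌉₊ ⌊x⌋₊).filter Nat.Prime)`, the number of primes
in the real interval `[y, x]`:

* `abs_card_primes_Icc_ceil_floor_sub_le` — if `|ϑ(t) − t| ≤ C₀ t/log² t` for `t ≥ 2`, then for all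
  real `2 ≤ y ≤ x`: `|#{⌈y⌉ ≤ p ≤ ⌊x⌋} − (x/log x − y/log y)| ≤ (20 + 12 C₀) x/log² y`;
* `exists_abs_card_primes_Icc_ceil_floor_sub_le` — the packaged form: there is `C ≥ 0` with
  `|#{⌈y⌉ ≤ p ≤ ⌊x⌋} − (x/log x − y/log y)| ≤ C x/log² y` for all real `2 ≤ y ≤ x` (`C₀` from the
  prime number theorem with the de la Vallée Poussin error term,
  `Literature.NumberTheory.LFunctions.exists_abs_theta_sub_self_le_div_log_sq`, PROVED in the tree).

This is the prime count in the `(X, Y)`-format of the Buchstab induction for rough numbers — the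
`1 ≤ u ≤ 2` base case of Lichtman's Lemma 6.1 is `Φ(x, y) = 1 + #{y ≤ p ≤ x}` for `y ≤ x < y²`
(`Literature/NumberTheory/Sieve/RoughNumbersBuchstab.lean`, `abs_card_roughIcc_sub_main_base`) — but
here for the bare prime count and with NO upper restriction on `x`.

Proof.  For `y ≥ e²` put `a = ⌈y⌉ − 1 ≥ y − 1 ≥ e`; then `{⌈y⌉ ≤ p ≤ ⌊x⌋} = {⌊a⌋ < p ≤ ⌊x⌋}`,
`abs_card_primes_Ioc_sub_le` (Abel summation through `ϑ`) gives
`#{⌊a⌋ < p ≤ ⌊x⌋} = x/log x − a/log a + O((1 + 3C₀) x/log² a)`, and `0 ≤ y/log y − a/log a ≤ 1 ≤ 4x/log² y`,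
`log y ≤ 2 log a`.  Small `y < e²` are trivial (`#{…} ≤ x`, `log 2 ≤ log y < 2`).  Constants are not
optimised.

## References

* H. L. Montgomery, R. C. Vaughan, *Multiplicative Number Theory I. Classical Theory*, CUP 2007,
  Theorem 6.9 (the prime number theorem with the de la Vallée Poussin error term), §2.1 (Abel
  summation). [MontgomeryVaughan2007]
* J. D. Lichtman, *A modification of the linear sieve, and the count of twin primes*, Algebra &
  Number Theory 19 (2025) 1–38, arXiv:2109.02851, Lemma 6.1 (the base case `u ≤ 2` of the
  rough-number asymptotics, where the main term is `x/log x − y/log y`). [Lichtman2025LinearSieve]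
-/

open Finset Real
open scoped Chebyshev

noncomputable section

namespace Literature.NumberTheory.LFunctions

/-! ### Trivial bounds -/

/-- `#{⌈y⌉ ≤ p ≤ ⌊x⌋} ≤ x` for `0 ≤ x` (primes are `≥ 1`, so the set lies in `[1, ⌊x⌋]`).
[folklore] -/
theorem card_primes_Icc_ceil_floor_le {x y : ℝ} (hx : 0 ≤ x) :
    (((Finset.Icc ⌈y⌉₊ ⌊x⌋₊).filter Nat.Prime).card : ℝ) ≤ x := by
  have h1 : ((Finset.Icc ⌈y⌉₊ ⌊x⌋₊).filter Nat.Prime).card ≤ ⌊x⌋₊ := by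
    calc ((Finset.Icc ⌈y⌉₊ ⌊x⌋₊).filter Nat.Prime).card ≤ (Finset.Icc 1 ⌊x⌋₊).card := by
          refine Finset.card_le_card fun p hp => ?_
          simp only [Finset.mem_filter, Finset.mem_Icc] at hp ⊢
          exact ⟨hp.2.one_lt.le, hp.1.2⟩
      _ = ⌊x⌋₊ := by simp
  calc (((Finset.Icc ⌈y⌉₊ ⌊x⌋₊).filter Nat.Prime).card : ℝ) ≤ ⌊x⌋₊ := by exact_mod_cast h1
    _ ≤ x := Nat.floor_le hx

/-- **The trivial bound** `|#{⌈y⌉ ≤ p ≤ ⌊x⌋} − (x/log x − y/log y)| ≤ 4x` for `2 ≤ y ≤ x`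
(`0 ≤ #{…} ≤ x` and `0 ≤ t/log t ≤ 3t/2` for `t ≥ 2`, as `log 2 > 2/3`). [folklore] -/
theorem abs_card_primes_Icc_ceil_floor_sub_le_four_mul {x y : ℝ} (hy : 2 ≤ y) (hyx : y ≤ x) :
    |(((Finset.Icc ⌈y⌉₊ ⌊x⌋₊).filter Nat.Prime).card : ℝ) - (x / Real.log x - y / Real.log y)| ≤
      4 * x := by
  have hx0 : 0 ≤ x := by linarith
  have hy0 : 0 ≤ y := by linarith
  have hl2 : (2 : ℝ) / 3 < Real.log 2 := by have := Real.log_two_gt_d9; linarith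
  have hly : Real.log 2 ≤ Real.log y := Real.log_le_log two_pos hy
  have hlx : Real.log y ≤ Real.log x := Real.log_le_log (by linarith) hyx
  have hly0 : 0 < Real.log y := by linarith
  have hlx0 : 0 < Real.log x := by linarith
  have hP := card_primes_Icc_ceil_floor_le (y := y) hx0
  have hP0 : (0 : ℝ) ≤ (((Finset.Icc ⌈y⌉₊ ⌊x⌋₊).filter Nat.Prime).card : ℝ) := Nat.cast_nonneg _
  have h1 : 0 ≤ x / Real.log x := by positivity
  have h2 : x / Real.log x ≤ 3 / 2 * x := by
    rw [div_le_iff₀ hlx0]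
    have : x * (2 / 3) ≤ x * Real.log x := mul_le_mul_of_nonneg_left (by linarith) hx0
    linarith
  have h3 : 0 ≤ y / Real.log y := by positivity
  have h4 : y / Real.log y ≤ 3 / 2 * x := by
    rw [div_le_iff₀ hly0]
    have : y * (2 / 3) ≤ y * Real.log y := mul_le_mul_of_nonneg_left (by linarith) hy0
    nlinarith
  rw [abs_le]
  constructor <;> linarith

/-- For `2 ≤ y < e²` (`y ≤ x`): `|#{⌈y⌉ ≤ p ≤ ⌊x⌋} − (x/log x − y/log y)| ≤ 16 x/log² y`
(the trivial bound and `log y < 2`). [folklore] -/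
theorem abs_card_primes_Icc_ceil_floor_sub_le_of_lt_exp_two {x y : ℝ} (hy : 2 ≤ y) (hyx : y ≤ x)
    (hy2 : y < Real.exp 2) :
    |(((Finset.Icc ⌈y⌉₊ ⌊x⌋₊).filter Nat.Prime).card : ℝ) - (x / Real.log x - y / Real.log y)| ≤
      16 * x / Real.log y ^ 2 := by
  have hx0 : 0 ≤ x := by linarith
  have hy0 : 0 < y := by linarith
  have hly0 : 0 < Real.log y := Real.log_pos (by linarith)
  have hly2 : Real.log y < 2 := by rw [Real.log_lt_iff_lt_exp hy0]; exact hy2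
  refine (abs_card_primes_Icc_ceil_floor_sub_le_four_mul hy hyx).trans ?_
  rw [le_div_iff₀ (by positivity)]
  have : Real.log y ^ 2 ≤ 4 := by nlinarith
  nlinarith

/-! ### The main estimate -/

/-- **Primes in `[y, x]` against `x/log x − y/log y`, for all `2 ≤ y ≤ x`.** If
`|ϑ(t) − t| ≤ C₀ t/log² t` for all `t ≥ 2` (`C₀ ≥ 0`), then
`|#{p prime : ⌈y⌉ ≤ p ≤ ⌊x⌋} − (x/log x − y/log y)| ≤ (20 + 12 C₀) x/log² y`.
For `y ≥ e²`: `a = ⌈y⌉ − 1 ≥ e`, `{⌈y⌉ ≤ p ≤ ⌊x⌋} = {⌊a⌋ < p ≤ ⌊x⌋}`,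
`#{⌊a⌋ < p ≤ ⌊x⌋} = x/log x − a/log a + O((1 + 3C₀) x/log² a)` (`abs_card_primes_Ioc_sub_le`),
`0 ≤ y/log y − a/log a ≤ 1 ≤ 4x/log² y` and `log² y ≤ 4 log² a`; `y < e²` is
`abs_card_primes_Icc_ceil_floor_sub_le_of_lt_exp_two` (the prime number theorem with the
de la Vallée Poussin error term, integrated by parts; the `u ≤ 2` base case of the rough-number
asymptotics). [cite: Lichtman2025LinearSieve, Lemma 6.1] -/
theorem abs_card_primes_Icc_ceil_floor_sub_le {C₀ : ℝ} (hC₀ : 0 ≤ C₀)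
    (hE : ∀ t : ℝ, 2 ≤ t → |θ t - t| ≤ C₀ * t / Real.log t ^ 2) {x y : ℝ} (hy : 2 ≤ y)
    (hyx : y ≤ x) :
    |(((Finset.Icc ⌈y⌉₊ ⌊x⌋₊).filter Nat.Prime).card : ℝ) - (x / Real.log x - y / Real.log y)| ≤
      (20 + 12 * C₀) * x / Real.log y ^ 2 := by
  have hx0 : 0 < x := by linarith
  rcases lt_or_ge y (Real.exp 2) with hy2 | hy2
  · refine (abs_card_primes_Icc_ceil_floor_sub_le_of_lt_exp_two hy hyx hy2).trans ?_
    rw [div_le_div_iff_of_pos_right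
      (by have := Real.log_pos (by linarith : (1 : ℝ) < y); positivity)]
    nlinarith
  -- `y ≥ e²`
  have he1 : (2 : ℝ) ≤ Real.exp 1 := by have := Real.add_one_le_exp (1 : ℝ); linarith
  have he2 : Real.exp 1 ≤ Real.exp 2 - 1 := by
    have h2 : Real.exp 2 = Real.exp 1 * Real.exp 1 := by rw [← Real.exp_add]; norm_num
    nlinarith
  have hy0 : 0 < y := by linarith
  have hy3 : 3 ≤ y := le_trans (by have := Real.add_one_le_exp (2 : ℝ); linarith) hy2
  have hy1 : 1 < y := by linarith
  have hly : 0 < Real.log y := Real.log_pos hy1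
  -- `N = ⌈y⌉`, `a = N − 1`
  set N := ⌈y⌉₊ with hN
  have hN1 : 0 < N := Nat.ceil_pos.mpr hy0
  set a : ℝ := ((N - 1 : ℕ) : ℝ) with ha_def
  have haN : a = (N : ℝ) - 1 := by rw [ha_def, Nat.cast_sub hN1, Nat.cast_one]
  have hyN : y ≤ N := Nat.le_ceil y
  have hNy : (N : ℝ) < y + 1 := Nat.ceil_lt_add_one hy0.le
  have hay : a ≤ y := by rw [haN]; linarith
  have hya : y ≤ a + 1 := by rw [haN]; linarith
  have hea : Real.exp 1 ≤ a := by linarith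
  have ha0 : 0 < a := (Real.exp_pos 1).trans_le hea
  have hla : 1 ≤ Real.log a := by rw [Real.le_log_iff_exp_le ha0]; exact hea
  have hlay : Real.log a ≤ Real.log y := Real.log_le_log ha0 hay
  have hax : a ≤ x := hay.trans hyx
  have hasq : y ≤ a ^ 2 := by
    have h1 : y - 1 ≤ a := by linarith
    have h2 : (y - 1) ^ 2 ≤ a ^ 2 := pow_le_pow_left₀ (by linarith) h1 2
    have h3 : y ≤ (y - 1) ^ 2 := by nlinarith
    exact h3.trans h2
  have hlya : Real.log y ≤ 2 * Real.log a := by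
    calc Real.log y ≤ Real.log (a ^ 2) := Real.log_le_log hy0 hasq
      _ = 2 * Real.log a := by rw [Real.log_pow]; norm_num
  -- `{⌈y⌉ ≤ p ≤ ⌊x⌋} = {⌊a⌋ < p ≤ ⌊x⌋}`
  have hfloor_a : ⌊a⌋₊ = N - 1 := by rw [ha_def, Nat.floor_natCast]
  have hPeq : (Finset.Icc N ⌊x⌋₊).filter Nat.Prime = (Finset.Ioc ⌊a⌋₊ ⌊x⌋₊).filter Nat.Prime := by
    rw [hfloor_a]
    congr 1
    ext p
    simp only [Finset.mem_Icc, Finset.mem_Ioc]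
    omega
  rw [hPeq]
  -- `#{⌊a⌋ < p ≤ ⌊x⌋} = x/log x − a/log a + O(x/log² a)`
  have hprimes := abs_card_primes_Ioc_sub_le hea hax hC₀ hE
  -- `0 ≤ y/log y − a/log a ≤ 1`
  have hmono : a / Real.log a ≤ y / Real.log y := by
    have h := Real.log_div_self_antitoneOn hea (hea.trans hay) hay
    -- `h : log y / y ≤ log a / a`
    rw [div_le_div_iff₀ (by linarith) hly]
    have h' := (div_le_div_iff₀ hy0 ha0).mp h
    linarith
  have hdiff : y / Real.log y - a / Real.log a ≤ 1 := by
    have h1 : y / Real.log y ≤ y / Real.log a :=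
      div_le_div_of_nonneg_left hy0.le (by linarith) hlay
    have h2 : y / Real.log a - a / Real.log a ≤ 1 := by
      rw [← sub_div, div_le_one (by linarith)]; linarith
    linarith
  -- `log² y ≤ 4x` and `x/log² a ≤ 4 x/log² y`
  have hlogsq : Real.log y ^ 2 ≤ 4 * x := by
    have hs0 : 0 < Real.sqrt y := Real.sqrt_pos.mpr hy0
    have h1 : Real.log (Real.sqrt y) ≤ Real.sqrt y - 1 := Real.log_le_sub_one_of_pos hs0
    have h2 : Real.log y = 2 * Real.log (Real.sqrt y) := by rw [Real.log_sqrt hy0.le]; ring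
    have h4 : Real.log y ≤ 2 * Real.sqrt y := by linarith
    calc Real.log y ^ 2 ≤ (2 * Real.sqrt y) ^ 2 := pow_le_pow_left₀ hly.le h4 2
      _ = 4 * y := by rw [mul_pow, Real.sq_sqrt hy0.le]; norm_num
      _ ≤ 4 * x := by linarith
  have hratio : x / Real.log a ^ 2 ≤ 4 * (x / Real.log y ^ 2) := by
    rw [div_le_iff₀ (by positivity)]
    calc x = x / Real.log y ^ 2 * Real.log y ^ 2 := by field_simp
      _ ≤ x / Real.log y ^ 2 * (2 * Real.log a) ^ 2 := by gcongr
      _ = 4 * (x / Real.log y ^ 2) * Real.log a ^ 2 := by ring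
  have hU0 : 0 ≤ x / Real.log y ^ 2 := by positivity
  have h1U : (1 : ℝ) ≤ 4 * (x / Real.log y ^ 2) := by
    rw [mul_div_assoc', le_div_iff₀ (by positivity)]; linarith
  -- assembly
  have hkey : |(((Finset.Ioc ⌊a⌋₊ ⌊x⌋₊).filter Nat.Prime).card : ℝ) -
      (x / Real.log x - y / Real.log y)| ≤ 1 + (1 + 3 * C₀) * x / Real.log a ^ 2 := by
    have h := abs_le.mp hprimes
    rw [abs_le]
    constructor <;> linarith [h.1, h.2]
  calc _ ≤ 1 + (1 + 3 * C₀) * x / Real.log a ^ 2 := hkey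
    _ = 1 + (1 + 3 * C₀) * (x / Real.log a ^ 2) := by ring
    _ ≤ 4 * (x / Real.log y ^ 2) + (1 + 3 * C₀) * (4 * (x / Real.log y ^ 2)) := by gcongr
    _ = (8 + 12 * C₀) * (x / Real.log y ^ 2) := by ring
    _ ≤ (20 + 12 * C₀) * (x / Real.log y ^ 2) := by gcongr; norm_num
    _ = (20 + 12 * C₀) * x / Real.log y ^ 2 := mul_div_assoc' _ _ _

/-- **Primes in `[y, x]`, packaged**: there is `C ≥ 0` such that for all real `2 ≤ y ≤ x`,
`|#{p prime : ⌈y⌉ ≤ p ≤ ⌊x⌋} − (x/log x − y/log y)| ≤ C x/log² y`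
(`abs_card_primes_Icc_ceil_floor_sub_le` with the constant of
`exists_abs_theta_sub_self_le_div_log_sq`, the prime number theorem with the de la Vallée Poussin
error term — PROVED in the tree; the `u ≤ 2` base case of the rough-number asymptotics, valid here
for all `x ≥ y`). [cite: Lichtman2025LinearSieve, Lemma 6.1] -/
theorem exists_abs_card_primes_Icc_ceil_floor_sub_le :
    ∃ C : ℝ, 0 ≤ C ∧ ∀ x y : ℝ, 2 ≤ y → y ≤ x →
      |(((Finset.Icc ⌈y⌉₊ ⌊x⌋₊).filter Nat.Prime).card : ℝ) - (x / Real.log x - y / Real.log y)| ≤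
        C * x / Real.log y ^ 2 := by
  obtain ⟨C₀, hC₀, hE⟩ := exists_abs_theta_sub_self_le_div_log_sq
  exact ⟨20 + 12 * C₀, by positivity, fun x y hy hyx =>
    abs_card_primes_Icc_ceil_floor_sub_le hC₀ hE hy hyx⟩

end Literature.NumberTheory.LFunctions
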